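import Literature.NumberTheory.EllipticCurves.OpenImageMazurTwistProofs
import Literature.NumberTheory.EllipticCurves.OpenImageMazurAssemblyProofs
import HarnessLib

/-!
# Crux `FreyModularity` (stmt-ABC-11340), line `Sketch`, reshape 3: irreducibility of `ρ̄_{E,p}`
# is invariant under quadratic twists

Helper toward the registered glue stub `stub_freyFiveIrreducibleGlue` of the line `Sketch`
(`Summits/ABC/ABC/Cruxes/FreyModularity/Lines/Sketch.lean`): the normalisation of a Frey curve
`E_(a,b)` to `A ≡ −1 (mod 4)`, `2 ∣ B` may require the quadratic twist by `−1`
(`quadraticTwist_freyCurve_neg_one : (freyCurve A B).quadraticTwist (-1) = freyCurve B A`), and the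
existence of a `Γ_ℚ`-stable line in `E[p]` is a property of the PROJECTIVE representation, hence
twist-invariant.  In the tree's vocabulary: the additive isomorphism `E^{(d)}(K̄) ≃+ E(K̄)` which is
`Γ_K`-equivariant up to the sign `σ√d/√d` (`WeierstrassCurve.exists_addEquiv_geomPoints_quadraticTwist_signed`,
Silverman *AEC* X.5 Cor. 5.4) identifies the `Γ_K`-stable subgroups of the `p`-torsion on both
sides, because subgroups are closed under negation.

* `hasIrreducibleModPGaloisRep_of_addEquiv_signed` — transport of `HasIrreducibleModPGaloisRep`
  along an additive isomorphism of geometric points that is equivariant up to sign;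
* `stub_glue_twist` — the registered helper stub:
  `(W.quadraticTwist d).HasIrreducibleModPGaloisRep p ↔ W.HasIrreducibleModPGaloisRep p` (`d ≠ 0`).
-/

-- `Summit.<Summit>.<Problem>` is the mandated summit-side namespace (CONVENTIONS §2); for the
-- single-conjunct summit `ABC` the two coincide, so the duplicate `ABC.ABC` is deliberate.
set_option linter.dupNamespace false

noncomputable section

open Literature.NumberTheory.EllipticCurves
open WeierstrassCurve Field

namespace Summit.ABC.ABC.Theorems

universe u

/-- **Irreducibility of `ρ̄_{E,p}` is transported along an additive isomorphism `E(K̄) ≃+ E'(K̄)`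
that is `Γ_K`-equivariant up to sign** (each `σ` acts either as `e ∘ σ = σ ∘ e` or as
`e ∘ σ = −σ ∘ e`): the preimage of a `Γ_K`-stable subgroup of `E'[p]` is a `Γ_K`-stable subgroup of
`E[p]`, since subgroups are closed under negation. [folklore] -/
theorem hasIrreducibleModPGaloisRep_of_addEquiv_signed {F : Type u} [Field F]
    {W W' : WeierstrassCurve F} {p : ℕ} (e : geomPoints W ≃+ geomPoints W')
    (he : ∀ σ : absoluteGaloisGroup F,
      (∀ P, e (σ • P) = σ • e P) ∨ (∀ P, e (σ • P) = -(σ • e P)))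
    (h : W.HasIrreducibleModPGaloisRep p) : W'.HasIrreducibleModPGaloisRep p := by
  -- restriction of `e` to the `p`-torsion
  have htor : ∀ {P : geomPoints W}, P ∈ geomTorsion W p ↔ e P ∈ geomTorsion W' p := by
    intro P
    rw [geomTorsion, geomTorsion, AddSubgroup.torsionBy.nsmul_iff, AddSubgroup.torsionBy.nsmul_iff,
      ← map_nsmul, AddEquiv.map_eq_zero_iff]
  let eₚ : geomTorsion W p ≃+ geomTorsion W' p :=
    { toFun := fun P ↦ ⟨e (P : geomPoints W), htor.mp P.2⟩
      invFun := fun Q ↦ ⟨e.symm (Q : geomPoints W'), by rw [htor, e.apply_symm_apply]; exact Q.2⟩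
      left_inv := fun P ↦ Subtype.ext (e.symm_apply_apply _)
      right_inv := fun Q ↦ Subtype.ext (e.apply_symm_apply _)
      map_add' := fun P Q ↦ Subtype.ext (by
        change e ((P : geomPoints W) + Q) = e P + e Q
        exact map_add e _ _) }
  have heₚ : ∀ P : geomTorsion W p, ((eₚ P : geomTorsion W' p) : geomPoints W') =
      e (P : geomPoints W) := fun _ ↦ rfl
  intro H' hH'
  -- the preimage of `H'` is stable
  set H : AddSubgroup (geomTorsion W p) := H'.comap eₚ.toAddMonoidHom with hHdef
  have hmem : ∀ P : geomTorsion W p, P ∈ H ↔ eₚ P ∈ H' := fun P ↦ by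
    rw [hHdef, AddSubgroup.mem_comap]; rfl
  have hH : ∀ (σ : absoluteGaloisGroup F), ∀ P ∈ H, σ • P ∈ H := by
    intro σ P hP
    rw [hmem] at hP ⊢
    rcases he σ with hσ | hσ
    · have : eₚ (σ • P) = σ • eₚ P := Subtype.ext (by
        rw [heₚ, AddSubgroup.torsionBy.coe_smul, hσ, AddSubgroup.torsionBy.coe_smul, heₚ])
      rw [this]
      exact hH' σ _ hP
    · have : eₚ (σ • P) = -(σ • eₚ P) := Subtype.ext (by
        rw [heₚ, AddSubgroup.torsionBy.coe_smul, hσ, AddSubgroup.coe_neg,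
          AddSubgroup.torsionBy.coe_smul, heₚ])
      rw [this]
      exact H'.neg_mem (hH' σ _ hP)
  rcases h H hH with hbot | htop
  · left
    refine (AddSubgroup.eq_bot_iff_forall _).mpr fun Q hQ ↦ ?_
    have hQ' : eₚ.symm Q ∈ H := by rw [hmem, eₚ.apply_symm_apply]; exact hQ
    rw [hbot, AddSubgroup.mem_bot] at hQ'
    have := congrArg eₚ hQ'
    rwa [eₚ.apply_symm_apply, map_zero] at this
  · right
    refine (AddSubgroup.eq_top_iff' _).mpr fun Q ↦ ?_
    have hQ' : eₚ.symm Q ∈ H := by rw [htop]; exact AddSubgroup.mem_top _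
    rw [hmem, eₚ.apply_symm_apply] at hQ'
    exact hQ'

/-- **Helper stub `stub_glue_twist` of the line `Sketch` (reshape 3): irreducibility of `ρ̄_{E,p}`
is invariant under quadratic twists over `ℚ`.**  The signed-equivariant isomorphism
`E^{(d)}(ℚ̄) ≃+ E(ℚ̄)` (`WeierstrassCurve.exists_addEquiv_geomPoints_quadraticTwist_signed`, Silverman
*AEC* X.5 Cor. 5.4) and its inverse (again signed-equivariant) transport stable subgroups of the
`p`-torsion in both directions (`hasIrreducibleModPGaloisRep_of_addEquiv_signed`).
[cite: SilvermanAEC2009, X.5 Cor. 5.4] -/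
theorem stub_glue_twist :
    ∀ (W : WeierstrassCurve ℚ) (d : ℚ), d ≠ 0 → ∀ p : ℕ,
      (W.quadraticTwist d).HasIrreducibleModPGaloisRep p ↔ W.HasIrreducibleModPGaloisRep p := by
  intro W d hd p
  obtain ⟨f, hf⟩ := W.exists_addEquiv_geomPoints_quadraticTwist_signed hd
  -- the inverse is signed-equivariant as well
  have hf' : ∀ σ : absoluteGaloisGroup ℚ,
      (∀ Q, f.symm (σ • Q) = σ • f.symm Q) ∨ (∀ Q, f.symm (σ • Q) = -(σ • f.symm Q)) := by
    intro σ
    rcases hf σ with hσ | hσ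
    · left
      intro Q
      apply f.injective
      rw [f.apply_symm_apply, hσ, f.apply_symm_apply]
    · right
      intro Q
      apply f.injective
      rw [f.apply_symm_apply, map_neg, hσ, f.apply_symm_apply, neg_neg]
  exact ⟨fun h ↦ hasIrreducibleModPGaloisRep_of_addEquiv_signed f hf h,
    fun h ↦ hasIrreducibleModPGaloisRep_of_addEquiv_signed f.symm hf' h⟩

end Summit.ABC.ABC.Theorems

end
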